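import Summits.QuantumAdvantage.QuantumAdvantage.Theorems.CharDialSubRankC

/-! # CharDialSubRank — part 4/4 (mechanical split for landing of `CharDialSubRank`; content verbatim; scopes re-opened with their variables) -/

noncomputable section
open Finset
open Summit.QuantumAdvantage.AdviceFreeQNC0 Summit.QuantumAdvantage.AdviceFreeQNC0.JLinPeel

/-! # §25 THE SUBCUBE RANK INDUCTION: junta ⊕ form data of rank `≤ r` lose, FOR EVERY `r` (`p ≥ 5`)

**Theorem (`subRank_hard`).**  For `p ≥ 5` there is ONE `θ < 1` such that for every rank `r` and every `K`:
eventually in `n`, for every coordinate subcube `{u_W = β}` with `n ≤ K·(n − |W|)` and every `r`-form dial of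
`log₂ n`-junta tables over ANY `r` directions `A`, `#{u : WIN(merge_W β u)} ≤ θ·2ⁿ`.

*Proof (induction on `r`, `K` universal).*  DENSE CASE — every nonzero combination `Σ t_j A_j` has `≥ (n−|W|)/2`
nonzero coefficients OFF `W`: transport to the free cube (§22: the subcube game is a generalised-bell game with
`n + 1 ≤ (K+1)·N` bells, the dial is the generalised dial of the restricted directions with class strategies shifted
by the constant `W`-part, juntas stay `≤ log₂ n ≤ (log₂ N)²`, relative density = density of the restriction) and apply
`form_reductionRG` (§24); `2^{|W|}·θ₁·2^N = θ₁·2ⁿ`.  SPARSE CASE — some `t ≠ 0` has `< (n−|W|)/2` nonzero coefficients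
off `W`: enlarge `W` by them (`W'`, `n ≤ 2K·(n − |W'|)`); on each finer subcube the combination `Σ_j t_j⟨A_j,u⟩` is a
CONSTANT `σ`, so with `t_{j₀} ≠ 0` the class vector is an affine function of the `r − 1` values `(⟨A_j,u⟩)_{j ≠ j₀}` and
the strategy is, on that subcube, an `(r−1)`-form dial of re-indexed junta tables (`Fin.insertNth`); the induction
hypothesis at `(r − 1, 2K)` bounds every finer subcube and fibre counting (`JLinPeel.sum_card_subcube`) sums them.  Rank `0` is the
dense case vacuously.  ∎

COROLLARIES (`W = ∅`, `K = 1`): `rankR_hard` (tables level), `rankLe_hard_unif` / `rankLe_hard` (data level, spelled: the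
well-spread hypothesis of part 18's `spreadRank_hard` is gone).  In the workshop node these read `RankLeHard p r` for every
`r`, so item 32604 at `p` is equivalent to hardness for strategies of UNBOUNDED semantic rank only. -/

namespace Summit.QuantumAdvantage.AdviceFreeQNC0.JLinPeel

open AffBells22 AffBells23 Subcube

section SubRank

variable (p : ℕ) [Fact p.Prime] {n : ℕ}

/-- a linear form at an extended point: constant `W`-part plus the restricted form. -/
theorem linF_ext (W : Finset (Fin n)) (β : Fin n → Bool) (a : Fin n → ZMod p) (v : Fin (n - W.card) → Bool) :
    WindowCounter.linF p a (ext W β v) = (∑ i ∈ W, if β i = true then a i else 0) + WindowCounter.linF p (res W a) v := by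
  unfold WindowCounter.linF
  exact SubcubeBells.sum_ext_split W β v a

/-- the class vector at an extended point. -/
theorem vecF_ext {r : ℕ} (W : Finset (Fin n)) (β : Fin n → Bool) (A : Fin r → Fin n → ZMod p)
    (v : Fin (n - W.card) → Bool) :
    WindowCounter.vecF p A (ext W β v) =
      (fun j => ∑ i ∈ W, if β i = true then A j i else 0) + WindowCounter.vecF p (fun j => res W (A j)) v := by
  funext j
  simp only [WindowCounter.vecF, Pi.add_apply, linF_ext]

/-- **the dense case**: all nonzero combinations dense off `W` ⟹ transport (§22) + generalised reduction (§24). -/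
theorem subRank_dense (hp : 5 ≤ p) : ∃ θ : ℝ, θ < 1 ∧ ∀ r K : ℕ, ∃ n₀ : ℕ, ∀ n ≥ n₀,
    ∀ (W : Finset (Fin n)) (β : Fin n → Bool) (c : ℕ) (A : Fin r → Fin n → ZMod p)
      (Y : (Fin r → ZMod p) → Fin (n + 1) → (Fin n → Bool) → Bool),
      n ≤ K * (n - W.card) →
      (∀ s g, ∃ J : Finset (Fin n), J.card ≤ Nat.log 2 n ∧ ∀ u v : Fin n → Bool, (∀ i ∈ J, u i = v i) →
        Y s g u = Y s g v) →
      (∀ t : Fin r → ZMod p, t ≠ 0 →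
        n - W.card ≤ 2 * (univ.filter fun i : Fin n => i ∉ W ∧ WindowCounter.comb p t A i ≠ 0).card) →
      ((univ.filter fun u : Fin n → Bool =>
          ringWinU c (WindowCounter.formStratR p A Y) (subcubeMerge W β u) = true).card : ℝ) ≤ θ * 2 ^ n := by
  obtain ⟨θ₁, hθ₁, hred⟩ := WindowCounter.form_reductionRG p hp
  refine ⟨θ₁, hθ₁, fun r K => ?_⟩
  obtain ⟨N₀, hN₀⟩ := hred r (K + 1)
  obtain ⟨N₁, hN₁⟩ := WindowCounter.log_le_sq_log K
  set M := max (max N₀ N₁) 1 with hM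
  refine ⟨max 1 (K * M), fun n hn W β c A Y hK hY hdense => ?_⟩
  set N := n - W.card with hNdef
  have hWn : W.card + N = n := card_add_sub W
  have hn1 : 1 ≤ n := le_trans (le_max_left _ _) hn
  have hKM : K * M ≤ n := le_trans (le_max_right _ _) hn
  have hK1 : 1 ≤ K := by
    rcases Nat.eq_zero_or_pos K with hK0 | hK0
    · rw [hK0, zero_mul] at hK; omega
    · exact hK0
  have hMN : M ≤ N := by
    by_contra h
    push Not at h
    have h' : N + 1 ≤ M := h
    nlinarith [Nat.mul_le_mul_left K h']
  have hNN₀ : N₀ ≤ N := le_trans (le_trans (le_max_left _ _) (le_max_left _ _)) hMN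
  have hNN₁ : N₁ ≤ N := le_trans (le_trans (le_max_right _ _) (le_max_left _ _)) hMN
  have hN1 : 1 ≤ N := le_trans (le_max_right _ _) hMN
  -- counting on the subcube ≤ 2^{|W|} · counting on the free cube
  have h1 := card_filter_merge_le W β (fun u : Fin n → Bool => ringWinU c (WindowCounter.formStratR p A Y) u = true)
  -- the free game is the generalised `r`-form dial of the restricted directions
  set σ : Fin r → ZMod p := fun j => ∑ i ∈ W, if β i = true then A j i else 0 with hσ
  set A' : Fin r → Fin N → ZMod p := fun j => res W (A j) with hA'
  set Y' : (Fin r → ZMod p) → Fin (n + 1) → (Fin N → Bool) → Bool := fun s g v => Y (σ + s) g (ext W β v) with hY'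
  have hstr : (fun g (v : Fin N → Bool) => WindowCounter.formStratR p A Y g (ext W β v)) =
      WindowCounter.formStratRG p A' Y' := by
    funext g v
    show Y (WindowCounter.vecF p A (ext W β v)) g (ext W β v) = Y (σ + WindowCounter.vecF p A' v) g (ext W β v)
    rw [vecF_ext]
  have h2 : ∀ v : Fin N → Bool, ringWinU c (WindowCounter.formStratR p A Y) (ext W β v) =
      ringWinGen (fun g : Fin (n + 1) => cut W g.val)
        (fun g : Fin (n + 1) => c + g.val + (SubcubeBells.wW W β + SubcubeBells.pW W β g.val))
        (WindowCounter.formStratRG p A' Y') v := fun v => by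
    rw [SubcubeBells.ringWinU_ext, hstr]
  -- the generalised reduction applies
  have hm : n + 1 ≤ (K + 1) * N := by
    calc n + 1 ≤ K * N + N := add_le_add hK hN1
      _ = (K + 1) * N := by ring
  have hdense' : ∀ t : Fin r → ZMod p, t ≠ 0 →
      N ≤ 2 * (univ.filter fun j : Fin N => WindowCounter.comb p t A' j ≠ 0).card := fun t ht => by
    have e : (univ.filter fun j : Fin N => WindowCounter.comb p t A' j ≠ 0).card =
        (univ.filter fun i : Fin n => i ∉ W ∧ WindowCounter.comb p t A i ≠ 0).card :=
      SubcubeBells.card_supp_res W (WindowCounter.comb p t A)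
    rw [e]
    exact hdense t ht
  have hY'' : ∀ s g, ∃ J : Finset (Fin N), J.card ≤ (Nat.log 2 N) ^ 2 ∧ ∀ u v : Fin N → Bool,
      (∀ i ∈ J, u i = v i) → Y' s g u = Y' s g v := fun s g => by
    obtain ⟨J, hJ, hdep⟩ := hY (σ + s) g
    obtain ⟨J', hJ', hdep'⟩ := SubcubeBells.junta_ext W β (f := fun u => Y (σ + s) g u) hdep
    exact ⟨J', hJ'.trans (hJ.trans (hN₁ N hNN₁ n hK)), hdep'⟩
  have h3 := hN₀ N hNN₀ (n + 1) hm (fun g : Fin (n + 1) => cut W g.val)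
    (fun g : Fin (n + 1) => c + g.val + (SubcubeBells.wW W β + SubcubeBells.pW W β g.val)) A' Y' hdense' hY''
  have h4 : ((univ.filter fun v : Fin N → Bool =>
      ringWinU c (WindowCounter.formStratR p A Y) (ext W β v) = true).card : ℝ) ≤ θ₁ * 2 ^ N := by
    have e : (univ.filter fun v : Fin N → Bool => ringWinU c (WindowCounter.formStratR p A Y) (ext W β v) = true) =
        univ.filter fun v : Fin N → Bool => ringWinGen (fun g : Fin (n + 1) => cut W g.val)
          (fun g : Fin (n + 1) => c + g.val + (SubcubeBells.wW W β + SubcubeBells.pW W β g.val))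
          (WindowCounter.formStratRG p A' Y') v = true := filter_congr fun v _ => by rw [h2]
    rw [e]
    exact h3
  have h2n : (2 : ℝ) ^ n = 2 ^ W.card * 2 ^ N := by rw [← pow_add, hWn]
  calc ((univ.filter fun u : Fin n → Bool =>
          ringWinU c (WindowCounter.formStratR p A Y) (subcubeMerge W β u) = true).card : ℝ)
      ≤ 2 ^ W.card * ((univ.filter fun v : Fin N → Bool =>
          ringWinU c (WindowCounter.formStratR p A Y) (ext W β v) = true).card : ℝ) := by exact_mod_cast h1
    _ ≤ 2 ^ W.card * (θ₁ * 2 ^ N) := mul_le_mul_of_nonneg_left h4 (by positivity)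
    _ = θ₁ * 2 ^ n := by rw [h2n]; ring

/-- **THE SUBCUBE RANK INDUCTION** (`p ≥ 5`): ONE `θ < 1`; every rank `r`, every subcube budget `K`; ANY directions. -/
theorem subRank_hard (hp : 5 ≤ p) : ∃ θ : ℝ, θ < 1 ∧ ∀ r K : ℕ, ∃ n₀ : ℕ, ∀ n ≥ n₀,
    ∀ (W : Finset (Fin n)) (β : Fin n → Bool) (c : ℕ) (A : Fin r → Fin n → ZMod p)
      (Y : (Fin r → ZMod p) → Fin (n + 1) → (Fin n → Bool) → Bool),
      n ≤ K * (n - W.card) →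
      (∀ s g, ∃ J : Finset (Fin n), J.card ≤ Nat.log 2 n ∧ ∀ u v : Fin n → Bool, (∀ i ∈ J, u i = v i) →
        Y s g u = Y s g v) →
      ((univ.filter fun u : Fin n → Bool =>
          ringWinU c (WindowCounter.formStratR p A Y) (subcubeMerge W β u) = true).card : ℝ) ≤ θ * 2 ^ n := by
  obtain ⟨θ, hθ, hdense⟩ := subRank_dense p hp
  refine ⟨θ, hθ, fun r => ?_⟩
  induction r with
  | zero =>
    intro K
    obtain ⟨n₀, hn₀⟩ := hdense 0 K
    exact ⟨n₀, fun n hn W β c A Y hK hY => hn₀ n hn W β c A Y hK hY fun t ht => (ht (funext fun j => j.elim0)).elim⟩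
  | succ r ih =>
    intro K
    obtain ⟨n₀, hn₀⟩ := hdense (r + 1) K
    obtain ⟨n₁, hn₁⟩ := ih (2 * K)
    refine ⟨max n₀ n₁, fun n hn W β c A Y hK hY => ?_⟩
    by_cases hd : ∀ t : Fin (r + 1) → ZMod p, t ≠ 0 →
        n - W.card ≤ 2 * (univ.filter fun i : Fin n => i ∉ W ∧ WindowCounter.comb p t A i ≠ 0).card
    · exact hn₀ n (le_trans (le_max_left _ _) hn) W β c A Y hK hY hd
    push Not at hd
    obtain ⟨t, ht, hsparse⟩ := hd
    -- the sparse combination: fix its off-`W` support too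
    set S : Finset (Fin n) := univ.filter fun i : Fin n => i ∉ W ∧ WindowCounter.comb p t A i ≠ 0 with hS
    set W' : Finset (Fin n) := W ∪ S with hW'
    have hWW' : W ⊆ W' := subset_union_left
    have hcW' : W'.card ≤ W.card + S.card := card_union_le _ _
    have hWn : W.card ≤ n := by simpa using card_le_univ W
    have hW'n : W'.card ≤ n := by simpa using card_le_univ W'
    have hK' : n ≤ 2 * K * (n - W'.card) := by
      have h2 : n - W.card ≤ 2 * (n - W'.card) := by omega
      calc n ≤ K * (n - W.card) := hK
        _ ≤ K * (2 * (n - W'.card)) := Nat.mul_le_mul_left _ h2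
        _ = 2 * K * (n - W'.card) := by ring
    have hzero : ∀ i, i ∉ W' → WindowCounter.comb p t A i = 0 := fun i hi => by
      by_contra h
      exact hi (mem_union_right _ (mem_filter.2 ⟨mem_univ _, fun hW => hi (mem_union_left _ hW), h⟩))
    obtain ⟨j₀, hj₀⟩ : ∃ j₀, t j₀ ≠ 0 := by
      by_contra h
      push Not at h
      exact ht (funext h)
    set A' : Fin r → Fin n → ZMod p := fun j => A (j₀.succAbove j) with hA'
    -- every finer subcube is an `r`-form dial of junta tables, bounded by the induction hypothesis
    have hfib : ∀ b : Fin n → Bool, ((univ.filter fun u : Fin n → Bool =>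
        ringWinU c (WindowCounter.formStratR p A Y) (subcubeMerge W β (subcubeMerge W' b u)) = true).card : ℝ) ≤
          θ * 2 ^ n := by
      intro b
      have hconst : ∀ u : Fin n → Bool,
          WindowCounter.linF p (WindowCounter.comb p t A) (subcubeMerge W' (subcubeMerge W β b) u) =
            WindowCounter.linF p (WindowCounter.comb p t A) (subcubeMerge W β b) := fun u => by
        unfold WindowCounter.linF
        refine sum_congr rfl fun i _ => ?_
        by_cases hi : i ∈ W'
        · simp [subcubeMerge, hi]
        · simp [hzero i hi]
      set σ : ZMod p := WindowCounter.linF p (WindowCounter.comb p t A) (subcubeMerge W β b) with hσ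
      set Φ : (Fin r → ZMod p) → (Fin (r + 1) → ZMod p) :=
        fun s' => Fin.insertNth j₀ ((t j₀)⁻¹ * (σ - ∑ j, t (j₀.succAbove j) * s' j)) s' with hΦ
      set Y'' : (Fin r → ZMod p) → Fin (n + 1) → (Fin n → Bool) → Bool := fun s' g u => Y (Φ s') g u with hY''
      have hvec : ∀ u : Fin n → Bool, WindowCounter.vecF p A (subcubeMerge W' (subcubeMerge W β b) u) =
          Φ (WindowCounter.vecF p A' (subcubeMerge W' (subcubeMerge W β b) u)) := by
        intro u
        set u' := subcubeMerge W' (subcubeMerge W β b) u with hu'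
        have hrel : t j₀ * WindowCounter.vecF p A u' j₀ +
            ∑ j : Fin r, t (j₀.succAbove j) * WindowCounter.vecF p A u' (j₀.succAbove j) = σ := by
          rw [← Fin.sum_univ_succAbove (fun j => t j * WindowCounter.vecF p A u' j) j₀]
          show ∑ j, t j * WindowCounter.linF p (A j) u' = σ
          rw [← WindowCounter.linF_comb, hconst]
        have hx : WindowCounter.vecF p A u' j₀ =
            (t j₀)⁻¹ * (σ - ∑ j : Fin r, t (j₀.succAbove j) * WindowCounter.vecF p A u' (j₀.succAbove j)) := by
          rw [← hrel, add_sub_cancel_right, ← mul_assoc, inv_mul_cancel₀ hj₀, one_mul]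
        calc WindowCounter.vecF p A u'
            = Fin.insertNth j₀ (WindowCounter.vecF p A u' j₀) (Fin.removeNth j₀ (WindowCounter.vecF p A u')) :=
              (Fin.insertNth_self_removeNth j₀ _).symm
          _ = Φ (WindowCounter.vecF p A' u') := by
              rw [hx]
              rfl
      have hcount : (univ.filter fun u : Fin n → Bool =>
          ringWinU c (WindowCounter.formStratR p A Y) (subcubeMerge W β (subcubeMerge W' b u)) = true) =
          univ.filter fun u : Fin n → Bool =>
            ringWinU c (WindowCounter.formStratR p A' Y'') (subcubeMerge W' (subcubeMerge W β b) u) = true := by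
        refine filter_congr fun u _ => ?_
        have hyg : ∀ g, WindowCounter.formStratR p A Y g (subcubeMerge W' (subcubeMerge W β b) u) =
            WindowCounter.formStratR p A' Y'' g (subcubeMerge W' (subcubeMerge W β b) u) := fun g => by
          show Y (WindowCounter.vecF p A (subcubeMerge W' (subcubeMerge W β b) u)) g _ =
            Y (Φ (WindowCounter.vecF p A' (subcubeMerge W' (subcubeMerge W β b) u))) g _
          rw [hvec u]
        rw [SubcubeBells.merge_merge_of_subset hWW', UnreadTwist.ringWinU_congr hyg]
      rw [hcount]
      exact hn₁ n (le_trans (le_max_right _ _) hn) W' (subcubeMerge W β b) c A' Y'' hK' fun s' g => hY (Φ s') g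
    -- fibre counting over the finer subcubes
    have hsum := JLinPeel.sum_card_subcube W'
      (fun u : Fin n → Bool => ringWinU c (WindowCounter.formStratR p A Y) (subcubeMerge W β u) = true)
    have h2n : (0 : ℝ) < 2 ^ n := by positivity
    have hmain : (2 : ℝ) ^ n * ((univ.filter fun u : Fin n → Bool =>
        ringWinU c (WindowCounter.formStratR p A Y) (subcubeMerge W β u) = true).card : ℝ) ≤ 2 ^ n * (θ * 2 ^ n) := by
      have e : (2 : ℝ) ^ n * ((univ.filter fun u : Fin n → Bool =>
          ringWinU c (WindowCounter.formStratR p A Y) (subcubeMerge W β u) = true).card : ℝ) =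
          ∑ b : Fin n → Bool, ((univ.filter fun u : Fin n → Bool =>
            ringWinU c (WindowCounter.formStratR p A Y) (subcubeMerge W β (subcubeMerge W' b u)) = true).card : ℝ) := by
        exact_mod_cast hsum.symm
      rw [e]
      calc _ ≤ ∑ b : Fin n → Bool, θ * 2 ^ n := sum_le_sum fun b _ => hfib b
        _ = 2 ^ n * (θ * 2 ^ n) := by
            rw [sum_const, card_univ, Fintype.card_fun, Fintype.card_bool, Fintype.card_fin, nsmul_eq_mul]
            push_cast; ring
    exact le_of_mul_le_mul_left hmain h2n

/-- **every `r`-form dial of `log₂ n`-junta tables over ANY `r` directions loses, ONE rate for all `r`** (`W = ∅`). -/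
theorem rankR_hard (hp : 5 ≤ p) : ∃ θ : ℝ, θ < 1 ∧ ∀ r : ℕ, ∃ n₀ : ℕ, ∀ n ≥ n₀, ∀ (c : ℕ)
    (A : Fin r → Fin n → ZMod p) (Y : (Fin r → ZMod p) → Fin (n + 1) → (Fin n → Bool) → Bool),
      (∀ s g, ∃ J : Finset (Fin n), J.card ≤ Nat.log 2 n ∧ ∀ u v : Fin n → Bool, (∀ i ∈ J, u i = v i) →
        Y s g u = Y s g v) →
      ((univ.filter fun u : Fin n → Bool => ringWinU c (WindowCounter.formStratR p A Y) u = true).card : ℝ) ≤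
        θ * 2 ^ n := by
  obtain ⟨θ, hθ, h⟩ := subRank_hard p hp
  refine ⟨θ, hθ, fun r => ?_⟩
  obtain ⟨n₀, hn₀⟩ := h r 1
  refine ⟨n₀, fun n hn c A Y hY => ?_⟩
  have := hn₀ n hn ∅ (fun _ => false) c A Y (by simp) hY
  simpa [SubcubeBells.merge_empty] using this

end SubRank


section RankCorollaries

variable (p : ℕ) [Fact p.Prime]

/-- **`L_r` FOR EVERY `r`, ONE RATE** (data level, spelled): for `p ≥ 5` there is `θ < 1` such that for every `r`, eventually
in `n`, `log₂ n`-junta ⊕ form data whose non-blind cuts' forms lie in the span of ANY `r` directions lose. -/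
theorem rankLe_hard_unif (hp : 5 ≤ p) :
    ∃ θ : ℝ, θ < 1 ∧ ∀ r : ℕ, ∃ n₀ : ℕ, ∀ n ≥ n₀, ∀ (c : ℕ) (D : JLinData p n), (∀ g, (D.J g).card ≤ Nat.log 2 n) →
      (∃ A : Fin r → Fin n → ZMod p,
        ∀ g, ¬ (∀ u s s', D.h g u s = D.h g u s') → ∃ l : Fin r → ZMod p, D.a g = fun i => ∑ j, l j * A j i) →
      (winCount c D.strat : ℝ) ≤ θ * (2 : ℝ) ^ n := by
  obtain ⟨θ, hθ, h⟩ := rankR_hard p hp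
  refine ⟨θ, hθ, fun r => ?_⟩
  obtain ⟨n₀, hn₀⟩ := h r
  refine ⟨n₀, fun n hn c D hJ hR => ?_⟩
  obtain ⟨A, hA⟩ := hR
  obtain ⟨Y, hY, hstrat⟩ := strat_eq_formStratR D A hA
  rw [hstrat]
  exact hn₀ n hn c A Y fun s g => ⟨D.J g, hJ g, fun u v huv => hY s g u v huv⟩

/-- **`L_r` for every `r`** in the per-rank shape of part 18's `spreadRank_hard`, WITHOUT the well-spread hypothesis. -/
theorem rankLe_hard (hp : 5 ≤ p) (r : ℕ) :
    ∃ θ : ℝ, θ < 1 ∧ ∃ n₀ : ℕ, ∀ n ≥ n₀, ∀ (c : ℕ) (D : JLinData p n), (∀ g, (D.J g).card ≤ Nat.log 2 n) →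
      (∃ A : Fin r → Fin n → ZMod p,
        ∀ g, ¬ (∀ u s s', D.h g u s = D.h g u s') → ∃ l : Fin r → ZMod p, D.a g = fun i => ∑ j, l j * A j i) →
      (winCount c D.strat : ℝ) ≤ θ * (2 : ℝ) ^ n := by
  obtain ⟨θ, hθ, h⟩ := rankLe_hard_unif p hp
  obtain ⟨n₀, hn₀⟩ := h r
  exact ⟨θ, hθ, n₀, hn₀⟩

/-- **the tree rung R5 sits inside the residual**: hardness for ALL `log₂ n`-junta ⊕ form data at the prime `p` (CharDial's
item at `p`, spelled) implies `WalkHardFLinSel p` — a linear test `[⟨ℓ_g,u⟩ = r_g]` is junta-free form data with the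
table `s ↦ [s = r_g]`. -/
theorem walkHardFLinSel_of_jLinHard
    (h : ∃ θ : ℝ, θ < 1 ∧ ∃ n₀ : ℕ, ∀ n ≥ n₀, ∀ (c : ℕ) (D : JLinData p n),
      (∀ g, (D.J g).card ≤ Nat.log 2 n) → (winCount c D.strat : ℝ) ≤ θ * (2 : ℝ) ^ n) :
    WalkHardFLinSel p := by
  obtain ⟨θ, hθ, n₀, hn₀⟩ := h
  refine ⟨θ, hθ, n₀, fun n hn c y hy => ?_⟩
  choose ℓ r hℓ using hy
  let D : JLinData p n := ⟨fun _ => ∅, ℓ, fun g _ s => decide (s = r g), fun g u v _ s => rfl⟩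
  have hD : D.strat = y := by
    funext g u
    rw [hℓ g u]
    rfl
  have h1 := hn₀ n hn c D (fun g => by simp [D])
  rw [hD] at h1
  simpa [winCount] using h1

end RankCorollaries

end Summit.QuantumAdvantage.AdviceFreeQNC0.JLinPeel
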